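import Mathlib
import Summits.AnomalousDissipation.AnomalousDissipation.Theses.PointSink
import Literature.Analysis.FluidPDE.WholeSpaceIBP

/-!
# `PointSink.SolitonTransplant` (stmt-AnomalousDissipation-19035): the free-space weighted steady
energy identity (support file for `PointSinkSolitonTransplantCoreEnergyFlux.lean`)

Lead record (line `Sketch`, continuation seat c1), free-space twin of
`Negative/PointSinkLocalEnergy.lean`.

* `freeSpace_steady_weighted_energy_identity` — for a smooth steady ZERO-FORCE Navier–Stokes
  solution `(c, π)` on `ℝ³` with viscosity `ν` and every compactly supported smooth weight `ψ`,
  `∫ (½‖c‖² + π) Dψ[c] = ν ∫ ψ |∇c|² + ν ∫ ∑ᵢ ∂ᵢψ ⟪c, ∂ᵢc⟫`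
  (whole-space integration by parts against the compactly supported field `ψ c`:
  `integral_inner_convect_add_eq_zero`, `integral_inner_gradient_eq_neg_integral_mul_divergence`,
  `integral_inner_laplacian_add_eq_zero`; no decay of `c` is needed).
The consequence for the exact core family of a cascade soliton (its inward energy flux through
every sphere tends to `D`) is in `PointSinkSolitonTransplantCoreEnergyFlux.lean`.

Pure proof file; no definitions, no named facts. [folklore]
-/

-- `Summit.<Summit>.<Problem>` is the tree's mandated summit-side namespace (CONVENTIONS §2); for this
-- single-conjunct summit the two coincide, so the duplicate is deliberate.
set_option linter.dupNamespace false

noncomputable section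

namespace Summit.AnomalousDissipation.AnomalousDissipation.Theorems

open MeasureTheory Filter Topology Set Metric Function
open scoped InnerProductSpace ContDiff Laplacian
open Literature.Analysis.FunctionSpaces Literature.Analysis.FluidPDE

/-! ### The free-space weighted steady energy identity -/

/-- `⟪v, ∇θ(x)⟫ = Dθ(x)[v]`. [folklore] -/
private theorem inner_gradient_right_eq (θ : (EuclideanSpace ℝ (Fin 3)) → ℝ) (x v : (EuclideanSpace ℝ (Fin 3))) :
    ⟪v, gradient θ x⟫_ℝ = fderiv ℝ θ x v := by
  rw [real_inner_comm, gradient, InnerProductSpace.toDual_symm_apply]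

/-- **Free-space weighted steady energy identity.** For a smooth steady solution `(c, π)` of the
zero-force Navier–Stokes system with viscosity `ν` on `ℝ³` and a compactly supported smooth weight
`ψ`: `∫ (½‖c‖² + π) Dψ[c] = ν ∫ ψ |∇c|² + ν ∫ ∑ᵢ ∂ᵢψ ⟪c, ∂ᵢc⟫` (`|∇c|²` the Frobenius norm of
`Dc`, `∂ᵢ` along the standard basis). Pair the momentum equation `(c·∇)c = νΔc − ∇π` with the
compactly supported field `ψ c` and integrate by parts on the whole space: the convective term
gives `−½∫Dψ[c]‖c‖²` (transport identity, `div c = 0`), the pressure `−∫⟪∇π, ψc⟫ = ∫ π Dψ[c]`,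
the viscous term `−ν∫ψ|∇c|² − ν∫∑∂ᵢψ⟪c,∂ᵢc⟫` (Green). [folklore] -/
theorem freeSpace_steady_weighted_energy_identity {ν : ℝ} {c : (EuclideanSpace ℝ (Fin 3)) → (EuclideanSpace ℝ (Fin 3))} {π : (EuclideanSpace ℝ (Fin 3)) → ℝ}
    (h : IsClassicalNSSolutionOn Set.univ ν (fun _ _ => 0) (fun _ => c) (fun _ => π))
    {ψ : (EuclideanSpace ℝ (Fin 3)) → ℝ} (hψ : ContDiff ℝ ∞ ψ) (hψc : HasCompactSupport ψ) :
    ∫ x, (2⁻¹ * ‖c x‖ ^ 2 + π x) * fderiv ℝ ψ x (c x) =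
      ν * (∫ x, ψ x * frobeniusNormSq (fderiv ℝ c x)) +
        ν * (∫ x, ∑ i, fderiv ℝ ψ x (EuclideanSpace.basisFun (Fin 3) ℝ i) *
          ⟪c x, fderiv ℝ c x (EuclideanSpace.basisFun (Fin 3) ℝ i)⟫_ℝ) := by
  -- smoothness
  have hc : ContDiff ℝ ∞ c := h.contDiff_velocity (Set.mem_univ (0 : ℝ))
  have hπ : ContDiff ℝ ∞ π := h.contDiff_pressure (Set.mem_univ (0 : ℝ))
  have hc1 : ContDiff ℝ 1 c := hc.of_le (by exact_mod_cast le_top)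
  have hc2 : ContDiff ℝ 2 c := contDiff_infty.1 hc 2
  have hπ1 : ContDiff ℝ 1 π := hπ.of_le (by exact_mod_cast le_top)
  have hψ1 : ContDiff ℝ 1 ψ := hψ.of_le (by exact_mod_cast le_top)
  have hdiv : ∀ x, VectorCalculus.divergence c x = 0 := h.divFree 0 (Set.mem_univ (0 : ℝ))
  have hmom : ∀ x, convect c c x = ν • (Δ c) x - gradient π x := by
    intro x
    have hm := h.momentum 0 (Set.mem_univ _) x
    have ht : timeDerivWithin Set.univ (fun _ : ℝ => c) 0 x = 0 := by
      simp [timeDerivWithin_apply]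
    rw [ht, zero_add, add_zero] at hm
    exact hm
  -- the compactly supported test field `w = ψ c`
  set w : (EuclideanSpace ℝ (Fin 3)) → (EuclideanSpace ℝ (Fin 3)) := fun x => ψ x • c x with hw_def
  have hw : ContDiff ℝ ∞ w := hψ.smul hc
  have hw1 : ContDiff ℝ 1 w := hw.of_le (by exact_mod_cast le_top)
  have hwc : HasCompactSupport w := hψc.smul_right
  have hψDc : HasCompactSupport (fderiv ℝ ψ) := hψc.fderiv (𝕜 := ℝ)
  -- continuity facts
  have cc : Continuous c := hc.continuous
  have cπ : Continuous π := hπ.continuous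
  have cψ : Continuous ψ := hψ.continuous
  have cDc : Continuous (fderiv ℝ c) := hc1.continuous_fderiv one_ne_zero
  have cDψ : Continuous (fderiv ℝ ψ) := hψ1.continuous_fderiv one_ne_zero
  have cconv : Continuous (convect c c) := cDc.clm_apply cc
  have cΔ : Continuous (Δ c) := continuous_laplacian hc2
  have cgrad : Continuous (gradient π) := continuous_gradient_of_contDiff hπ1
  have cDψc : Continuous fun x => fderiv ℝ ψ x (c x) := cDψ.clm_apply cc
  -- compact support of everything carrying a factor `ψ` or `Dψ`
  have suppψ : ∀ {g : (EuclideanSpace ℝ (Fin 3)) → ℝ}, HasCompactSupport fun x => ψ x * g x := fun {g} =>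
    hψc.mul_right
  have suppDψ : ∀ {g : (EuclideanSpace ℝ (Fin 3)) → ℝ}, HasCompactSupport fun x => fderiv ℝ ψ x (c x) * g x := by
    intro g
    refine hψDc.mono fun x hx => ?_
    contrapose! hx
    simp only [mem_support, not_not] at hx ⊢
    simp [hx]
  -- (1) pairing the momentum equation with `w`
  have hA_int : Integrable (fun x => ⟪convect c c x, w x⟫_ℝ) := by
    refine (cconv.inner hw.continuous).integrable_of_hasCompactSupport (hwc.mono fun x hx => ?_)
    contrapose! hx
    simp only [mem_support, not_not] at hx ⊢
    simp [hx]
  have hL_int : Integrable (fun x => ⟪(Δ c) x, w x⟫_ℝ) := by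
    refine (cΔ.inner hw.continuous).integrable_of_hasCompactSupport (hwc.mono fun x hx => ?_)
    contrapose! hx
    simp only [mem_support, not_not] at hx ⊢
    simp [hx]
  have hP_int : Integrable (fun x => ⟪gradient π x, w x⟫_ℝ) := by
    refine (cgrad.inner hw.continuous).integrable_of_hasCompactSupport (hwc.mono fun x hx => ?_)
    contrapose! hx
    simp only [mem_support, not_not] at hx ⊢
    simp [hx]
  have hpair : ∫ x, ⟪convect c c x, w x⟫_ℝ =
      ν * (∫ x, ⟪(Δ c) x, w x⟫_ℝ) - ∫ x, ⟪gradient π x, w x⟫_ℝ := by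
    have hpt : ∀ x, ⟪convect c c x, w x⟫_ℝ = ν * ⟪(Δ c) x, w x⟫_ℝ - ⟪gradient π x, w x⟫_ℝ := by
      intro x
      rw [hmom x, inner_sub_left, real_inner_smul_left]
    simp_rw [hpt]
    rw [integral_sub (hL_int.const_mul ν) hP_int, integral_const_mul]
  -- (2) the convective term: `∫⟪(c·∇)c, ψc⟫ = −½ ∫ Dψ[c] ‖c‖²`
  have hconv := integral_inner_convect_add_eq_zero hc1 hc1 hw1 hwc
  have hdiv0 : ∫ x, VectorCalculus.divergence c x * ⟪c x, w x⟫_ℝ = 0 := by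
    simp [hdiv]
  have hB1_int : Integrable (fun x => ψ x * ⟪c x, convect c c x⟫_ℝ) :=
    (cψ.mul (cc.inner cconv)).integrable_of_hasCompactSupport suppψ
  have hB2_int : Integrable (fun x => fderiv ℝ ψ x (c x) * ‖c x‖ ^ 2) :=
    (cDψc.mul (cc.norm.pow 2)).integrable_of_hasCompactSupport suppDψ
  have hB : ∫ x, ⟪c x, convect c w x⟫_ℝ =
      (∫ x, ψ x * ⟪c x, convect c c x⟫_ℝ) + ∫ x, fderiv ℝ ψ x (c x) * ‖c x‖ ^ 2 := by
    rw [← integral_add hB1_int hB2_int]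
    refine integral_congr_ae (ae_of_all _ fun x => ?_)
    have hcs := convect_smul_apply (u := c) (w := c) (hψ1.differentiable one_ne_zero x)
      (hc1.differentiable one_ne_zero x)
    simp only [hw_def]
    rw [hcs, inner_add_right, real_inner_smul_right, real_inner_smul_right, real_inner_self_eq_norm_sq]
  have hA : ∫ x, ⟪convect c c x, w x⟫_ℝ = ∫ x, ψ x * ⟪c x, convect c c x⟫_ℝ := by
    refine integral_congr_ae (ae_of_all _ fun x => ?_)
    simp only [hw_def]
    rw [real_inner_smul_right, real_inner_comm]
  have hconv' : 2 * (∫ x, ψ x * ⟪c x, convect c c x⟫_ℝ) +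
      ∫ x, fderiv ℝ ψ x (c x) * ‖c x‖ ^ 2 = 0 := by
    rw [hA, hB, hdiv0] at hconv
    linarith
  -- (3) the pressure term: `∫⟪∇π, ψc⟫ = −∫ π Dψ[c]`
  have hpress : ∫ x, ⟪gradient π x, w x⟫_ℝ = -∫ x, π x * fderiv ℝ ψ x (c x) := by
    rw [integral_inner_gradient_eq_neg_integral_mul_divergence hπ1 hw1 hwc]
    congr 1
    refine integral_congr_ae (ae_of_all _ fun x => ?_)
    simp only [hw_def]
    rw [divergence_smul_apply (hψ1.differentiable one_ne_zero x) (hc1.differentiable one_ne_zero x), hdiv x,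
      mul_zero, zero_add, inner_gradient_right_eq]
  -- (4) the viscous term: `∫⟪Δc, ψc⟫ = −∫ψ|∇c|² − ∫∑∂ᵢψ⟪c,∂ᵢc⟫`
  have hgreen := integral_inner_laplacian_add_eq_zero (EuclideanSpace.basisFun (Fin 3) ℝ) hc2 hw1 (Or.inr hwc)
  have hDw : ∀ x i, fderiv ℝ w x ((EuclideanSpace.basisFun (Fin 3) ℝ) i) = ψ x • fderiv ℝ c x ((EuclideanSpace.basisFun (Fin 3) ℝ) i) + (fderiv ℝ ψ x ((EuclideanSpace.basisFun (Fin 3) ℝ) i)) • c x := by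
    intro x i
    simp only [hw_def]
    rw [fderiv_fun_smul (hψ1.differentiable one_ne_zero x) (hc1.differentiable one_ne_zero x)]
    simp [add_comm]
  have hV1_int : Integrable (fun x => ψ x * frobeniusNormSq (fderiv ℝ c x)) := by
    refine (cψ.mul ?_).integrable_of_hasCompactSupport suppψ
    simp_rw [frobeniusNormSq_eq_sum (EuclideanSpace.basisFun (Fin 3) ℝ)]
    exact continuous_finsetSum _ fun i _ => (cDc.clm_apply continuous_const).norm.pow 2
  have hV2i_int : ∀ i, Integrable (fun x => fderiv ℝ ψ x ((EuclideanSpace.basisFun (Fin 3) ℝ) i) * ⟪c x, fderiv ℝ c x ((EuclideanSpace.basisFun (Fin 3) ℝ) i)⟫_ℝ) := by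
    intro i
    refine ((cDψ.clm_apply continuous_const).mul (cc.inner (cDc.clm_apply continuous_const)))
      |>.integrable_of_hasCompactSupport (hψDc.mono fun x hx => ?_)
    contrapose! hx
    simp only [mem_support, not_not] at hx ⊢
    simp [hx]
  have hV1i_int : ∀ i, Integrable (fun x => ψ x * ‖fderiv ℝ c x ((EuclideanSpace.basisFun (Fin 3) ℝ) i)‖ ^ 2) := fun i =>
    (cψ.mul ((cDc.clm_apply continuous_const).norm.pow 2)).integrable_of_hasCompactSupport suppψ
  have hsum : ∑ i, ∫ x, ⟪fderiv ℝ c x ((EuclideanSpace.basisFun (Fin 3) ℝ) i), fderiv ℝ w x ((EuclideanSpace.basisFun (Fin 3) ℝ) i)⟫_ℝ =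
      (∫ x, ψ x * frobeniusNormSq (fderiv ℝ c x)) +
        ∫ x, ∑ i, fderiv ℝ ψ x ((EuclideanSpace.basisFun (Fin 3) ℝ) i) * ⟪c x, fderiv ℝ c x ((EuclideanSpace.basisFun (Fin 3) ℝ) i)⟫_ℝ := by
    have hterm : ∀ i, ∫ x, ⟪fderiv ℝ c x ((EuclideanSpace.basisFun (Fin 3) ℝ) i), fderiv ℝ w x ((EuclideanSpace.basisFun (Fin 3) ℝ) i)⟫_ℝ =
        (∫ x, ψ x * ‖fderiv ℝ c x ((EuclideanSpace.basisFun (Fin 3) ℝ) i)‖ ^ 2) +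
          ∫ x, fderiv ℝ ψ x ((EuclideanSpace.basisFun (Fin 3) ℝ) i) * ⟪c x, fderiv ℝ c x ((EuclideanSpace.basisFun (Fin 3) ℝ) i)⟫_ℝ := by
      intro i
      rw [← integral_add (hV1i_int i) (hV2i_int i)]
      refine integral_congr_ae (ae_of_all _ fun x => ?_)
      dsimp only
      rw [hDw x i, inner_add_right, real_inner_smul_right, real_inner_smul_right,
        real_inner_self_eq_norm_sq, real_inner_comm (c x)]
    simp_rw [hterm]
    rw [Finset.sum_add_distrib, ← integral_finsetSum _ fun i _ => hV1i_int i,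
      ← integral_finsetSum _ fun i _ => hV2i_int i]
    congr 1
    refine integral_congr_ae (ae_of_all _ fun x => ?_)
    dsimp only
    rw [frobeniusNormSq_eq_sum (EuclideanSpace.basisFun (Fin 3) ℝ), Finset.mul_sum]
  -- (5) assemble
  have hF_int : Integrable (fun x => (2⁻¹ * ‖c x‖ ^ 2 + π x) * fderiv ℝ ψ x (c x)) := by
    refine ((continuous_const.mul (cc.norm.pow 2)).add cπ).mul cDψc |>.integrable_of_hasCompactSupport ?_
    refine hψDc.mono fun x hx => ?_
    contrapose! hx
    simp only [mem_support, not_not] at hx ⊢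
    simp [hx]
  have hPi_int : Integrable (fun x => π x * fderiv ℝ ψ x (c x)) := by
    refine (cπ.mul cDψc).integrable_of_hasCompactSupport (hψDc.mono fun x hx => ?_)
    contrapose! hx
    simp only [mem_support, not_not] at hx ⊢
    simp [hx]
  have hsplit : ∫ x, (2⁻¹ * ‖c x‖ ^ 2 + π x) * fderiv ℝ ψ x (c x) =
      2⁻¹ * (∫ x, fderiv ℝ ψ x (c x) * ‖c x‖ ^ 2) + ∫ x, π x * fderiv ℝ ψ x (c x) := by
    rw [← integral_const_mul, ← integral_add (hB2_int.const_mul _) hPi_int]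
    refine integral_congr_ae (ae_of_all _ fun x => ?_)
    ring
  rw [hsplit]
  have h1 := hpair
  rw [hA, hpress] at h1
  have h2 : ∫ x, ⟪(Δ c) x, w x⟫_ℝ = -((∫ x, ψ x * frobeniusNormSq (fderiv ℝ c x)) +
      ∫ x, ∑ i, fderiv ℝ ψ x ((EuclideanSpace.basisFun (Fin 3) ℝ) i) * ⟪c x, fderiv ℝ c x ((EuclideanSpace.basisFun (Fin 3) ℝ) i)⟫_ℝ) := by
    rw [← hsum]; linarith
  rw [h2] at h1
  linarith

end Summit.AnomalousDissipation.AnomalousDissipation.Theorems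

end
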